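import Summits.SmoothPoincare4.SmoothPoincare4.Theorems.SymplecticOrigamiGromovRecognitionRelEndStubCapModelGlueACS
import Literature.Geometry.Manifold.OpenSubmanifoldTangent
import Literature.Geometry.Manifold.OpenSubmanifoldMFDeriv
import Mathlib.Geometry.Manifold.LocalDiffeomorph

/-!
# Wedge cap for `GromovRecognitionRelEnd` — open submanifolds and open smooth embeddings
(stub `stub_capModel` of line `cross-cap-laurent`, crux `SymplecticOrigami.GromovRecognitionRelEnd`,
item stmt-SmoothPoincare4-11009; generic auxiliary file)

Plumbing for the three coordinate pieces of the wedge cap, which are open subsets of `ℝ⁴`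
regarded as open submanifolds (`TopologicalSpace.Opens.instChartedSpace`):

* `toOpens U x₀ : X → U`, the corestriction to an open submanifold extended by the junk value
  `x₀` off `U`; it is `C^∞` on `U`, a local diffeomorphism at the points of `U` (inverse
  `Subtype.val`) with identity differential there (Lee 2013, Example 1.26, Prop. 3.9);
* `acsRestrict J U`, the restriction of an almost complex structure to an open submanifold
  (`T_x U = T_x X`; the trivialisations of `TU` and `TX` agree, tree file
  `OpenSubmanifoldTangent`);
* `isLocalDiffeomorph_of_emb`: a smooth embedding with open range is a local diffeomorphism
  (its inverse is `C^∞` on the range, tree file `SmoothEmbeddingInverse`).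
-/

noncomputable section

-- the registered namespace `Summit.SmoothPoincare4.SmoothPoincare4.Theorems…` repeats a component
set_option linter.dupNamespace false

open scoped Manifold ContDiff Topology
open Bundle Set Function Filter TopologicalSpace Literature.Geometry.Symplectic

namespace Summit.SmoothPoincare4.SmoothPoincare4.Theorems.GromovRecognitionRelEnd.CrossCapLaurent

namespace CapModel

variable {E : Type*} [NormedAddCommGroup E] [NormedSpace ℝ E] {H : Type*} [TopologicalSpace H]
  {I : ModelWithCorners ℝ E H} {X : Type*} [TopologicalSpace X] [ChartedSpace H X]

/-! ## Corestriction to an open submanifold -/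

section Opens

variable (U : Opens X) (x₀ : U)

/-- **Corestriction to an open submanifold**, junk value `x₀` off `U`. [folklore] -/
def toOpens (x : X) : U :=
  open scoped Classical in if hx : x ∈ U then ⟨x, hx⟩ else x₀

variable {U x₀}

/-- On `U` the corestriction is the point itself. [folklore] -/
theorem toOpens_of_mem {x : X} (hx : x ∈ U) : toOpens U x₀ x = ⟨x, hx⟩ := by
  simp only [toOpens, hx, dif_pos]

/-- On `U`, `val ∘ toOpens = id`. [folklore] -/
theorem val_toOpens {x : X} (hx : x ∈ U) : (toOpens U x₀ x).1 = x := by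
  rw [toOpens_of_mem hx]

/-- `toOpens ∘ val = id`. [folklore] -/
@[simp] theorem toOpens_val (u : U) : toOpens U x₀ u.1 = u := by
  rw [toOpens_of_mem u.2]

/-- Near a point of `U`, `val ∘ toOpens = id`. [folklore] -/
theorem eventually_val_toOpens {x : X} (hx : x ∈ U) :
    (Subtype.val ∘ toOpens U x₀) =ᶠ[𝓝 x] id := by
  filter_upwards [U.2.mem_nhds hx] with x' hx'
  exact val_toOpens hx'

/-- The corestriction is `C^∞` at the points of `U`. [cite: LeeSmoothManifolds2013, Example 1.26] -/
theorem contMDiffAt_toOpens {x : X} (hx : x ∈ U) : ContMDiffAt I I ∞ (toOpens U x₀) x := by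
  rw [← ContMDiffAt.subtypeVal_comp_iff]
  exact contMDiffAt_id.congr_of_eventuallyEq (eventually_val_toOpens hx)

/-- The corestriction is `C^∞` on `U`. [folklore] -/
theorem contMDiffOn_toOpens : ContMDiffOn I I ∞ (toOpens U x₀) U := fun _ hx =>
  (contMDiffAt_toOpens hx).contMDiffWithinAt

/-- **The corestriction is a local diffeomorphism at the points of `U`** (inverse: the
inclusion). [cite: LeeSmoothManifolds2013, Example 1.26] -/
theorem isLocalDiffeomorphAt_toOpens {x : X} (hx : x ∈ U) :
    IsLocalDiffeomorphAt I I ∞ (toOpens U x₀) x := by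
  refine ⟨{ toFun := toOpens U x₀
            invFun := Subtype.val
            source := U
            target := univ
            map_source' := fun _ _ => mem_univ _
            map_target' := fun u _ => u.2
            left_inv' := fun _ hx => val_toOpens hx
            right_inv' := fun u _ => toOpens_val u
            open_source := U.2
            open_target := isOpen_univ
            contMDiffOn_toFun := contMDiffOn_toOpens
            contMDiffOn_invFun := contMDiff_subtype_val.contMDiffOn }, hx, fun _ _ => rfl⟩

/-- **The corestriction has identity differential** at the points of `U` (`T_x U = T_x X`).
[cite: LeeSmoothManifolds2013, Prop. 3.9] -/
theorem mfderiv_toOpens_apply {x : X} (hx : x ∈ U) (v : TangentSpace I x) :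
    mfderiv I I (toOpens U x₀) x v = v := by
  have h1 : MDifferentiableAt I I (Subtype.val : U → X) (toOpens U x₀ x) :=
    Literature.Geometry.Manifold.OpenSubmanifold.mdifferentiableAt_subtype_val _
  have h2 : MDifferentiableAt I I (toOpens U x₀) x :=
    (contMDiffAt_toOpens hx).mdifferentiableAt (by simp)
  have h := mfderiv_comp x h1 h2
  rw [(eventually_val_toOpens hx).mfderiv_eq, mfderiv_id,
    Literature.Geometry.Manifold.OpenSubmanifold.mfderiv_subtype_val] at h
  exact (congrArg (fun L : TangentSpace I x →L[ℝ] TangentSpace I x => L v) h).symm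

/-- The differential of the inclusion of an open submanifold, applied. [folklore] -/
theorem mfderiv_val_apply (u : U) (v : TangentSpace I u) :
    mfderiv I I (Subtype.val : U → X) u v = v := by
  rw [Literature.Geometry.Manifold.OpenSubmanifold.mfderiv_subtype_val]; rfl

end Opens

/-! ## Restriction of an almost complex structure to an open submanifold -/

section Restrict

variable [IsManifold I ∞ X]

/-- **Endomorphism fields restrict to open submanifolds**: a `C^n` section of `End(TX)` read on
`U` is a `C^n` section of `End(TU)` (the trivialisations of `TU` are those of `TX`, O'Neill 1983,
Ch. 2 pp. 36–37). [folklore] -/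
theorem contMDiff_endSection_opens {n : WithTop ℕ∞}
    {J : (x : X) → TangentSpace I x →L[ℝ] TangentSpace I x}
    (hJ : ContMDiff I (I.prod 𝓘(ℝ, E →L[ℝ] E)) n
      (fun x => TotalSpace.mk' (E →L[ℝ] E)
        (E := fun x : X => TangentSpace I x →L[ℝ] TangentSpace I x) x (J x)))
    (U : Opens X) :
    ContMDiff I (I.prod 𝓘(ℝ, E →L[ℝ] E)) n
      (fun u : U => TotalSpace.mk' (E →L[ℝ] E)
        (E := fun u : U => TangentSpace I u →L[ℝ] TangentSpace I u) u (J u.1)) := by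
  intro u₀
  have hX := ((contMDiffAt_hom_bundle _).1 (hJ u₀.1)).2.comp u₀ contMDiff_subtype_val.contMDiffAt
  rw [contMDiffAt_hom_bundle]
  refine ⟨contMDiffAt_id, hX.congr_of_eventuallyEq ?_⟩
  have hnhds : ∀ᶠ u : U in 𝓝 u₀, u.1 ∈ (chartAt H u₀.1).source :=
    continuous_subtype_val.continuousAt.preimage_mem_nhds
      ((chartAt H u₀.1).open_source.mem_nhds (mem_chart_source H u₀.1))
  filter_upwards [hnhds] with u hu
  simp only [Function.comp_apply, ContinuousLinearMap.inCoordinates]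
  rw [Literature.Geometry.Manifold.OpenSubmanifold.continuousLinearMapAt_trivializationAt_eq hu,
    Literature.Geometry.Manifold.OpenSubmanifold.symmL_trivializationAt_eq hu]
  rfl

/-- **Restriction of an almost complex structure to an open submanifold.** [cite: McDuffSalamon2017, §4.1] -/
def acsRestrict (J : AlmostComplexStructure I ∞ X) (U : Opens X) : AlmostComplexStructure I ∞ U where
  toFun u := J u.1
  map_map' u v := J.map_map u.1 v
  contMDiff' := contMDiff_endSection_opens J.contMDiff U

/-- The restricted structure is the original one on each tangent space. [folklore] -/
@[simp] theorem acsRestrict_apply (J : AlmostComplexStructure I ∞ X) (U : Opens X) (u : U)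
    (v : TangentSpace I u) : acsRestrict J U u v = J u.1 v := rfl

end Restrict

/-! ## Open smooth embeddings are local diffeomorphisms -/

section Emb

variable {P : Type*} [TopologicalSpace P] [ChartedSpace H P]
  {E' : Type*} [NormedAddCommGroup E'] [NormedSpace ℝ E'] {H' : Type*} [TopologicalSpace H']
  {I' : ModelWithCorners ℝ E' H'} {Y : Type*} [TopologicalSpace Y] [ChartedSpace H' Y]
  [Nonempty P] {e : P → Y}

/-- **A smooth embedding with open range is a local diffeomorphism** (indeed a diffeomorphism
onto its range: the inverse is `C^∞` there). [cite: LeeSmoothManifolds2013, Prop. 4.22] -/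
theorem isLocalDiffeomorph_of_emb (hem : Manifold.IsSmoothEmbedding I I' ∞ e)
    (hop : IsOpen (range e)) : IsLocalDiffeomorph I I' ∞ e := by
  have hinj := hem.isEmbedding.injective
  intro p
  refine ⟨{ toFun := e
            invFun := invFun e
            source := univ
            target := range e
            map_source' := fun q _ => mem_range_self q
            map_target' := fun _ _ => mem_univ _
            left_inv' := fun q _ => invFun_apply hinj q
            right_inv' := fun _ hy => apply_invFun hy
            open_source := isOpen_univ
            open_target := hop
            contMDiffOn_toFun := hem.contMDiff.contMDiffOn
            contMDiffOn_invFun := fun y hy => (contMDiffAt_invFun hem hop hy).contMDiffWithinAt },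
    mem_univ p, fun _ _ => rfl⟩

/-- A smooth embedding with open range is a local diffeomorphism at every point. [folklore] -/
theorem isLocalDiffeomorphAt_of_emb (hem : Manifold.IsSmoothEmbedding I I' ∞ e)
    (hop : IsOpen (range e)) (p : P) : IsLocalDiffeomorphAt I I' ∞ e p :=
  isLocalDiffeomorph_of_emb hem hop p

end Emb

end CapModel

/-- **Registered helper sub-goal `helper_capModelOpenEmbLocalDiffeo`** (generic auxiliary file of
stub `stub_capModel`): a smooth embedding of `4`-manifolds with open range is a `C^∞` local
diffeomorphism. [cite: LeeSmoothManifolds2013, Prop. 4.22] -/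
theorem helper_capModelOpenEmbLocalDiffeo : ∀ (P X : Type) [TopologicalSpace P]
    [ChartedSpace (EuclideanSpace ℝ (Fin 4)) P] [IsManifold (𝓡 4) ∞ P] [TopologicalSpace X]
    [ChartedSpace (EuclideanSpace ℝ (Fin 4)) X] [IsManifold (𝓡 4) ∞ X] [Nonempty P] (e : P → X),
    Manifold.IsSmoothEmbedding (𝓡 4) (𝓡 4) ∞ e → IsOpen (Set.range e) →
    IsLocalDiffeomorph (𝓡 4) (𝓡 4) ∞ e :=
  fun _ _ _ _ _ _ _ _ _ _ hem hop => CapModel.isLocalDiffeomorph_of_emb hem hop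

end Summit.SmoothPoincare4.SmoothPoincare4.Theorems.GromovRecognitionRelEnd.CrossCapLaurent
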